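import Literature.MathematicalPhysics.QuantumFieldTheory.ConstructiveQFTWave0
import Literature.MathematicalPhysics.QuantumLattice.LatticeGaugeDLR
import Literature.MathematicalPhysics.QuantumLattice.YangMillsClassical
import HarnessLib

/-!
# The Wilson (gradient) flow of lattice gauge fields (Lüscher 2010)

Topic `Literature/MathematicalPhysics/QuantumLattice` (definition request `defn-latticeWilsonFlow`,
wanted by the routes `FlowLineStateSpace` (Yang–Mills: cruxes `FlowedEnergyNonConcentration`,
`SmallFlowTimeReconstruction`, the scale `flowScale`) and `GradientFlowSpecies` (QCD: the
`wilsonFlow` request, whose items inline the same ODE for `SU(3)`)).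

**Source.** M. Lüscher, *Properties and uses of the Wilson flow in lattice QCD*, JHEP 08 (2010)
071, arXiv:1006.4518 [Luscher2010] (read: the published PDF, pp. 1–2, 8–9, 14–16):

* (1.3) `S_w(U) = g₀⁻² ∑ₚ Re tr{1 − U(p)}`, "`p` runs over all **oriented** plaquettes";
* (1.4) `V̇_t(x, μ) = −g₀² {∂_{x,μ} S_w(V_t)} V_t(x, μ)`, `V_t(x, μ)|_{t=0} = U(x, μ)`, "in which
  `∂_{x,μ}` stands for the natural `𝔰𝔲(3)`-valued differential operator with respect to the link
  variable" — App. A: `∂ᵃ_{x,μ} f(U) = (d/ds) f(e^{sX} U)|_{s=0}`, `X(y, ν) = Tᵃ δ_{(y,ν),(x,μ)}`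
  (A.3), `∂_{x,μ} = Tᵃ ∂ᵃ_{x,μ}` (A.4, basis independent), `Tᵃ` anti-Hermitian with
  `tr{TᵃTᵇ} = −½ δᵃᵇ` (A.2); App. C (C.1): the flow equation is `V̇_t = Z(V_t) V_t` with `Z(V_t)`
  in the Lie algebra of the (finite power of the) gauge group;
* p. 2: "The existence, uniqueness and smoothness of the Wilson flow at all positive and negative
  times `t` is rigorously guaranteed on a finite lattice [Arnold, ODE]. Moreover, from eq. (1.4)
  one immediately concludes that the action `S_w(V_t)` is a monotonically decreasing function of
  `t`";
* (3.1) `E = 2 ∑_{p ∈ P_x} Re tr{1 − V_t(p)}`, "`P_x` being the set of unoriented plaquettes with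
  lower-left corner `x`"; Fig. 1: "the anti-hermitian traceless part of the average of the four
  plaquette Wilson loops [in the `(μ, ν)`-plane, same orientation, starting and ending at `x`]
  can be taken as the definition of the field tensor `a² G_{μν}(x)`", `E = ¼ Gᵃ_{μν} Gᵃ_{μν}`
  (2.1); (3.3) the reference scale `t₀`: `{t² ⟨E⟩}_{t = t₀} = 0.3` (vendored by `flowScale`).

**The explicit vector field (derived here from (1.3), (1.4), (A.2)–(A.4); recorded for the
reviewer).** Fix a link `e = (x, μ)`. Each of the `2(d−1)` unoriented plaquettes through `e`
appears twice in (1.3) (both orientations, equal real parts of traces), and can be based at `x`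
and oriented to start with `V(e)`, so that `g₀² S_w(V) = −2 Re tr Ω_e(V) + (terms without V(e))`,
`Ω_e(V) := ∑_{ν ≠ μ} [V(x,μ)V(x+μ̂,ν)V(x+ν̂,μ)⁻¹V(x,ν)⁻¹ + V(x,μ)V(x+μ̂−ν̂,ν)⁻¹V(x−ν̂,μ)⁻¹V(x−ν̂,ν)]`
(`plaquetteSum`). Hence `∂ᵃ_e (g₀² S_w)(V) = −2 Re tr(Tᵃ Ω_e)` and
`g₀² ∂_e S_w(V) = ∑ₐ (−2 Re tr(Tᵃ Ω_e)) Tᵃ = π_𝔤(Ω_e(V))`, the orthogonal projection of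
`Ω_e(V)` onto the Lie algebra `𝔤` for the real Hilbert–Schmidt inner product
`⟨X, Y⟩ = Re tr(X† Y)` on `M_N(ℂ)` (the `Tᵃ` are `⟨·,·⟩`-orthogonal of square norm `½`, and for
`X ∈ 𝔤 ⊆ 𝔲(N)` one has `⟨X, W⟩ = −Re tr(X W)`). For `𝔤 = 𝔰𝔲(N)`:
`π(W) = ½(W − W†) − (2N)⁻¹ tr(W − W†)·1`, Lüscher's projector (the form inlined, for `N = 3`, in
the QCD route's items). So (1.4) reads **`V̇_t(e) = −π_𝔤(Ω_e(V_t)) · V_t(e)`**: minus the Riemannian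
gradient of `∑_{unoriented p} Re tr(1 − V(p))` (the tree's `wilsonAction`) for the bi-invariant
metric `⟨X, Y⟩ = Re tr(X†Y)` on each link, flow time in lattice units `a²`.

## Contents (all definitions have bodies; everything stated is proved)

* `frobeniusInnerProductSpace` — the real Hilbert–Schmidt inner product `Re tr(A† B)` on
  `Matrix m n ℂ`, compatible with Mathlib's scoped Frobenius norm (a `def`; activate with
  `attribute [local instance]`).
* `oneParamGenerators H`, `matrixLieAlgebra H`, `lieProjection H` — the Lie algebra
  `{X | ∀ t, exp(tX) ∈ H}` of a matrix group `H ⊆ M_N(ℂ)` (its real span; equal to the set for a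
  closed subgroup, von Neumann–Cartan) and the orthogonal projection `π_𝔤` onto it.
* Generic lattice: sites `Fin d → R` (`R = ZMod L`: the torus of `GaugeConfig d L G`;
  `R = ℤ`: `ℤ^d` of `LGConfig d G`), links `(x, μ)`, matrix link fields `MatrixLinkField d R N`.
  `plaquetteSum` (`Ω_e`), `wilsonFlowGenerator` (`Z(V)(e) = −π_𝔤 Ω_e(V)`), `wilsonFlowField`
  (`Z(V)(e) V(e)`), `IsWilsonFlowLine` (a global solution of (1.4), entrywise `HasDerivAt`, all
  `t ∈ ℝ`), `matrixWilsonFlow` (the flow; junk value the initial field if no global flow line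
  exists — it always does for unitary data, Lüscher p. 2).
* Gauge-group level, for `ρ : G →* M_N(ℂ)` (faithful continuous unitary in all uses, cf. the
  tree's `LatticeRep`): `wilsonFlowMatrix ρ t U` (the flowed link matrices `ρ`-image),
  `latticeWilsonFlow ρ t U` (the flowed configuration pulled back to `G` along the injective `ρ`),
  `flowedPlaquette`, `flowedEnergy` ((3.1), lattice units), `flowedClover` (Fig. 1),
  `flowedCloverEnergy` ((2.1) with Fig. 1).
* Proved here: the inner-product bookkeeping, `lieProjection` lands in `𝔤` and fixes `𝔤`,
  `matrixWilsonFlow_zero`, `latticeWilsonFlow_zero`, `isWilsonFlowLine_matrixWilsonFlow`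
  (the flow is a flow line whenever one exists), and `sum_flowedEnergy_zero`
  (`∑ₓ E₀(x) = 2 · wilsonAction ρ U` for unitary `ρ`: consistency with the tree's Wilson action).

Deliberately NOT here (follow-up `…Proofs` files of this definition item): global existence and
uniqueness of flow lines for unitary initial data (Picard–Lindelöf on the finite-dimensional link
space, unitarity is preserved because `Z(V)` is skew-Hermitian), continuity in `U`, the group
law, gauge and lattice-symmetry covariance, monotonicity of `S_w(V_t)`, the identification
`matrixLieAlgebra (range ρ) = 𝔰𝔲(N)` for the fundamental `SU(N)`, and the fact that the flow
stays in `ρ(G)` (so that `ρ ∘ latticeWilsonFlow ρ t U = wilsonFlowMatrix ρ t U`); Lüscher's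
quark flow (arXiv:1302.5246) and the finite-speed/quasi-locality estimate are separate notions.

## References

* M. Lüscher, JHEP 08 (2010) 071, arXiv:1006.4518, eqs. (1.3)–(1.4), (2.1), (3.1), (3.3),
  App. A (A.2)–(A.4), App. C (C.1). [Luscher2010]
* M. Lüscher, Commun. Math. Phys. 293 (2010) 899, arXiv:0907.5491, §3 (the Wilson flow as the
  generator of trivializing maps; same equation).
* K. Wilson, Phys. Rev. D 10 (1974) 2445 (the action). [Wilson1974]
-/

noncomputable section

open scoped Matrix.Norms.Frobenius
open Matrix

namespace Literature.MathematicalPhysics.QuantumLattice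

/-! ### The real Hilbert–Schmidt (Frobenius) inner product on complex matrices -/

section FrobeniusInner

variable {m n : Type*} [Fintype m] [Fintype n]

/-- The real Hilbert–Schmidt inner product `⟨A, B⟩ = Re tr(A† B) = ∑ᵢⱼ Re(conj Aᵢⱼ · Bᵢⱼ)` on
`Matrix m n ℂ`, as an `InnerProductSpace ℝ` structure whose norm IS Mathlib's (scoped) Frobenius
norm `Matrix.frobeniusNormedSpace` (so no instance diamond arises under
`open scoped Matrix.Norms.Frobenius`). A `def`, not a global instance (Mathlib deliberately has no
canonical matrix norm); files activate it with `attribute [local instance]`. This is the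
bi-invariant metric of Lüscher's App. A up to the factor in (A.2). [folklore] -/
@[reducible] def frobeniusInnerProductSpace : InnerProductSpace ℝ (Matrix m n ℂ) :=
  { Matrix.frobeniusNormedSpace with
    inner := fun A B => (Matrix.trace (Aᴴ * B)).re
    norm_sq_eq_re_inner := fun A => by
      simp only [RCLike.re_to_real]
      rw [Matrix.frobenius_norm_sq_eq_re_trace]
      rfl
    conj_inner_symm := fun A B => by
      have h : Bᴴ * A = (Aᴴ * B)ᴴ := by rw [conjTranspose_mul, conjTranspose_conjTranspose]
      simp only [RCLike.conj_to_real]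
      rw [h, trace_conjTranspose, Complex.star_def, Complex.conj_re]
    add_left := fun A B C => by
      simp only [conjTranspose_add, Matrix.add_mul, trace_add, Complex.add_re]
    smul_left := fun A B r => by
      simp only [conjTranspose_smul, star_trivial, Matrix.smul_mul, trace_smul, Complex.smul_re,
        RCLike.conj_to_real, smul_eq_mul] }

attribute [local instance] frobeniusInnerProductSpace

/-- Unfolding: `⟨A, B⟩ = Re tr(A† B)`. [folklore] -/
theorem frobenius_inner_def (A B : Matrix m n ℂ) : inner ℝ A B = (Matrix.trace (Aᴴ * B)).re := rfl

/-- Entrywise form: `⟨A, B⟩ = ∑ᵢ ∑ⱼ Re(conj Aᵢⱼ · Bᵢⱼ)`. [folklore] -/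
theorem frobenius_inner_eq_sum (A B : Matrix m n ℂ) :
    inner ℝ A B = ∑ i, ∑ j, ((starRingEnd ℂ) (A i j) * B i j).re := by
  rw [frobenius_inner_def, Matrix.trace]
  simp only [Matrix.diag, Matrix.mul_apply, conjTranspose_apply, Complex.star_def, Complex.re_sum]
  rw [Finset.sum_comm]

end FrobeniusInner

attribute [local instance] frobeniusInnerProductSpace

/-! ### The Lie algebra of a matrix group and the projection onto it -/

section LieAlgebra

variable {n : Type*} [Fintype n] [DecidableEq n]

/-- The generators of one-parameter subgroups of `H ⊆ M_n(ℂ)`: matrices `X` with `exp(tX) ∈ H`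
for all real `t`. For a closed subgroup `H` of `GL_n(ℂ)` this set is a real Lie subalgebra (von
Neumann 1929 / Cartan; the vector-space part follows from the Lie product formula, tree
`tendsto_lieTrotter`), the Lie algebra of `H`. [folklore] -/
def oneParamGenerators (H : Set (Matrix n n ℂ)) : Set (Matrix n n ℂ) :=
  {X | ∀ t : ℝ, NormedSpace.exp (t • X) ∈ H}

/-- Unfolding of `oneParamGenerators`. [folklore] -/
theorem mem_oneParamGenerators_iff {H : Set (Matrix n n ℂ)} {X : Matrix n n ℂ} :
    X ∈ oneParamGenerators H ↔ ∀ t : ℝ, NormedSpace.exp (t • X) ∈ H := Iff.rfl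

/-- `0` generates the trivial one-parameter subgroup, so lies in `oneParamGenerators H` as soon as
`1 ∈ H`. [folklore] -/
theorem zero_mem_oneParamGenerators {H : Set (Matrix n n ℂ)} (h1 : (1 : Matrix n n ℂ) ∈ H) :
    (0 : Matrix n n ℂ) ∈ oneParamGenerators H := fun t => by
  simpa only [smul_zero, NormedSpace.exp_zero] using h1

/-- `oneParamGenerators H` is closed under real scalars. [folklore] -/
theorem smul_mem_oneParamGenerators {H : Set (Matrix n n ℂ)} {X : Matrix n n ℂ}
    (hX : X ∈ oneParamGenerators H) (c : ℝ) : c • X ∈ oneParamGenerators H := fun t => by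
  simpa only [smul_smul] using hX (t * c)

/-- **The Lie algebra of the matrix group `H`**: the real span of the one-parameter generators
(equal to `oneParamGenerators H` itself when `H` is a closed subgroup — the closed-subgroup
theorem; the span makes the `Submodule` structure available without that theorem). For
`H = SU(N)` it is `𝔰𝔲(N)` = traceless anti-Hermitian matrices (Lüscher App. A), for `H = U(N)` the
anti-Hermitian matrices. [folklore] -/
def matrixLieAlgebra (H : Set (Matrix n n ℂ)) : Submodule ℝ (Matrix n n ℂ) :=
  Submodule.span ℝ (oneParamGenerators H)

/-- Generators lie in the Lie algebra. [folklore] -/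
theorem mem_matrixLieAlgebra_of_mem {H : Set (Matrix n n ℂ)} {X : Matrix n n ℂ}
    (hX : X ∈ oneParamGenerators H) : X ∈ matrixLieAlgebra H :=
  Submodule.subset_span hX

/-- **The projector `π_𝔤`**: the orthogonal projection of `M_n(ℂ)` onto `matrixLieAlgebra H` for
the real Hilbert–Schmidt inner product `Re tr(X† Y)` (Lüscher (A.4): `Tᵃ ∂ᵃ`, i.e. the component
along `𝔤` in an orthonormal basis — basis independent). For `𝔰𝔲(N)` this is
`W ↦ ½(W − W†) − (2N)⁻¹ tr(W − W†)·1`. [cite: Luscher2010, App. A eq. (A.4)] -/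
def lieProjection (H : Set (Matrix n n ℂ)) : Matrix n n ℂ →L[ℝ] Matrix n n ℂ :=
  (matrixLieAlgebra H).starProjection

/-- `π_𝔤 W ∈ 𝔤`. [folklore] -/
theorem lieProjection_mem (H : Set (Matrix n n ℂ)) (W : Matrix n n ℂ) :
    lieProjection H W ∈ matrixLieAlgebra H :=
  Submodule.starProjection_apply_mem _ W

/-- `π_𝔤` fixes `𝔤`. [folklore] -/
theorem lieProjection_eq_self {H : Set (Matrix n n ℂ)} {X : Matrix n n ℂ}
    (hX : X ∈ matrixLieAlgebra H) : lieProjection H X = X :=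
  Submodule.starProjection_eq_self_iff.2 hX

/-- The defining orthogonality: `Re tr(X† (W − π_𝔤 W)) = 0` for `X ∈ 𝔤`, i.e. `π_𝔤 W` is the
component of `W` along `𝔤` (Lüscher (A.4)). [folklore] -/
theorem inner_sub_lieProjection {H : Set (Matrix n n ℂ)} {X : Matrix n n ℂ}
    (hX : X ∈ matrixLieAlgebra H) (W : Matrix n n ℂ) :
    inner ℝ X (W - lieProjection H W) = 0 := by
  rw [inner_eq_zero_symm]
  exact Submodule.starProjection_inner_eq_zero W X hX

end LieAlgebra

/-! ### The lattice: sites `Fin d → R`, links, plaquette sums, the flow (matrix level) -/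

section MatrixLevel

variable {d : ℕ} {R : Type*} [AddGroup R] [One R] {N : ℕ}

/-- Matrix-valued link fields on the lattice with site type `Fin d → R` (`R = ZMod L`: the
discrete torus of `GaugeConfig d L`, `R = ℤ`: the lattice `ℤ^d` of `LGConfig d`); the link
`(x, μ)` runs from `x` to `x + μ̂ = x + Pi.single μ 1`. The ambient linear space in which the
flow equation (1.4) is an ODE (Lüscher App. C). [folklore] -/
abbrev MatrixLinkField (d : ℕ) (R : Type*) (N : ℕ) : Type _ :=
  (Fin d → R) × Fin d → Matrix (Fin N) (Fin N) ℂ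

/-- **The plaquette sum `Ω_e(V)` through the link `e = (x, μ)`**: the sum over `ν ≠ μ` of the two
plaquette loops containing `e`, based at `x` and oriented to start with `V(e)`,
`V(x,μ)V(x+μ̂,ν)V(x+ν̂,μ)†V(x,ν)† + V(x,μ)V(x+μ̂−ν̂,ν)†V(x−ν̂,μ)†V(x−ν̂,ν)` (reversed links enter
through `†`, which is the inverse on unitary link variables and keeps the field polynomial), so
that `g₀² S_w(V) = −2 Re tr Ω_e(V) + (terms not involving V(e))` by (1.3). [cite: Luscher2010, eqs. (1.3)–(1.4)] -/
def plaquetteSum (V : MatrixLinkField d R N) (e : (Fin d → R) × Fin d) :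
    Matrix (Fin N) (Fin N) ℂ :=
  ∑ ν : Fin d, if ν = e.2 then 0 else
    (V e * V (e.1 + Pi.single e.2 1, ν) * (V (e.1 + Pi.single ν 1, e.2))ᴴ * (V (e.1, ν))ᴴ +
      V e * (V (e.1 + Pi.single e.2 1 - Pi.single ν 1, ν))ᴴ * (V (e.1 - Pi.single ν 1, e.2))ᴴ *
        V (e.1 - Pi.single ν 1, ν))

/-- **Lüscher's generator `Z(V)(e) = −g₀² ∂_e S_w(V) = −π_𝔤(Ω_e(V))`** (App. C (C.1) with (1.4) and
(A.4)); an element of the Lie algebra `𝔤 = matrixLieAlgebra H` of the gauge group `H ⊆ M_N(ℂ)`. [cite: Luscher2010, eq. (1.4) and App. C eq. (C.1)] -/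
def wilsonFlowGenerator (H : Set (Matrix (Fin N) (Fin N) ℂ)) (V : MatrixLinkField d R N)
    (e : (Fin d → R) × Fin d) : Matrix (Fin N) (Fin N) ℂ :=
  -(lieProjection H (plaquetteSum V e))

/-- `Z(V)(e) ∈ 𝔤`. [folklore] -/
theorem wilsonFlowGenerator_mem (H : Set (Matrix (Fin N) (Fin N) ℂ)) (V : MatrixLinkField d R N)
    (e : (Fin d → R) × Fin d) : wilsonFlowGenerator H V e ∈ matrixLieAlgebra H :=
  Submodule.neg_mem _ (lieProjection_mem H _)

/-- **The Wilson-flow vector field** `V ↦ (e ↦ Z(V)(e) · V(e))`, the right-hand side of (1.4):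
`V̇(x,μ) = −g₀² {∂_{x,μ} S_w(V)} V(x,μ)`. [cite: Luscher2010, eq. (1.4)] -/
def wilsonFlowField (H : Set (Matrix (Fin N) (Fin N) ℂ)) (V : MatrixLinkField d R N) :
    MatrixLinkField d R N :=
  fun e => wilsonFlowGenerator H V e * V e

/-- **A (global) Wilson flow line starting at `V`**: `Φ : ℝ → (links → M_N(ℂ))` with `Φ 0 = V`
solving (1.4) at every real flow time, entry by entry:
`(d/ds) Φ_s(e)ᵢⱼ |_{s=t} = (Z(Φ_t)(e) Φ_t(e))ᵢⱼ`. (Entrywise derivatives keep the predicate free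
of any choice of matrix norm; on a finite lattice it is the ODE (C.1) in `M_N(ℂ)^{links}`.)
Lüscher, p. 2: for unitary `V` such a flow line exists for all positive and negative times and is
unique. [cite: Luscher2010, eq. (1.4)] -/
def IsWilsonFlowLine (H : Set (Matrix (Fin N) (Fin N) ℂ)) (V : MatrixLinkField d R N)
    (Φ : ℝ → MatrixLinkField d R N) : Prop :=
  Φ 0 = V ∧ ∀ (t : ℝ) (e : (Fin d → R) × Fin d) (i j : Fin N),
    HasDerivAt (fun s => Φ s e i j) (wilsonFlowField H (Φ t) e i j) t

open Classical in
/-- **The Wilson flow at the matrix level**, `V ↦ V_t`: the value at flow time `t` of a global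
flow line of (1.4) starting at `V` (unique whenever it exists, and it exists for unitary `V` and
`𝔤 ⊆ 𝔲(N)` — Lüscher p. 2, proved in the follow-up file), with the documented junk value `V`
(the constant field) when no global flow line exists (possible only off the unitary fields, where
the cubic vector field may blow up). Flow time is in lattice units (`t/a²`). [cite: Luscher2010, eq. (1.4)] -/
def matrixWilsonFlow (H : Set (Matrix (Fin N) (Fin N) ℂ)) (t : ℝ) (V : MatrixLinkField d R N) :
    MatrixLinkField d R N :=
  if h : ∃ Φ, IsWilsonFlowLine H V Φ then h.choose t else V

/-- At flow time `0` the flow is the identity (unconditionally: both branches of the definition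
start at `V`). [cite: Luscher2010, eq. (1.4)] -/
@[simp]
theorem matrixWilsonFlow_zero (H : Set (Matrix (Fin N) (Fin N) ℂ)) (V : MatrixLinkField d R N) :
    matrixWilsonFlow H 0 V = V := by
  unfold matrixWilsonFlow
  split_ifs with h
  · exact h.choose_spec.1
  · rfl

/-- Whenever some global flow line from `V` exists, `t ↦ matrixWilsonFlow H t V` is one. [folklore] -/
theorem isWilsonFlowLine_matrixWilsonFlow {H : Set (Matrix (Fin N) (Fin N) ℂ)}
    {V : MatrixLinkField d R N} (h : ∃ Φ, IsWilsonFlowLine H V Φ) :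
    IsWilsonFlowLine H V fun t => matrixWilsonFlow H t V := by
  have hfun : (fun t => matrixWilsonFlow H t V) = h.choose := by
    funext t
    exact dif_pos h
  rw [hfun]
  exact h.choose_spec

end MatrixLevel

/-! ### Gauge-group level: `ρ : G →* M_N(ℂ)` -/

section GroupLevel

variable {d : ℕ} {R : Type*} [AddGroup R] [One R] {N : ℕ} {G : Type*} [Group G]
variable (ρ : G →* Matrix (Fin N) (Fin N) ℂ)

/-- **The flowed link matrices** `V_t = (ρ(U))_t`: the Wilson flow (1.4) of the `ρ`-image of the
configuration `U`, run in `M_N(ℂ)` along the Lie algebra `matrixLieAlgebra (range ρ)` of the closed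
subgroup `ρ(G) ⊆ U(N)` (`ρ` a faithful continuous unitary representation of the compact group `G`
in every use, cf. `LatticeRep`; for `G = SU(N)` with its defining representation this is
Lüscher's `SU(N)` flow). Works verbatim on the torus (`U : GaugeConfig d L G`, `R = ZMod L`) and on
`ℤ^d` (`U : LGConfig d G`, `R = ℤ`). [cite: Luscher2010, eq. (1.4)] -/
def wilsonFlowMatrix (t : ℝ) (U : (Fin d → R) × Fin d → G) : MatrixLinkField d R N :=
  matrixWilsonFlow (Set.range ρ) t fun e => ρ (U e)

/-- **The lattice Wilson flow `U ↦ V_t(U)` as a `G`-valued configuration**: the flowed link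
matrices pulled back along `ρ` (`Function.invFun ρ`, the inverse on `range ρ` for injective `ρ`).
Meaningful because the flow of `ρ(U)` stays in `ρ(G)^{links}` (`Z(V) ∈ 𝔤 = Lie(ρ(G))`, Lüscher
App. C; proved in the follow-up file), in which case `ρ (latticeWilsonFlow ρ t U e) =
wilsonFlowMatrix ρ t U e`; off `range ρ` the value of `invFun` is an unspecified junk element. [cite: Luscher2010, eq. (1.4)] -/
def latticeWilsonFlow (t : ℝ) (U : (Fin d → R) × Fin d → G) : (Fin d → R) × Fin d → G :=
  fun e => Function.invFun ρ (wilsonFlowMatrix ρ t U e)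

/-- **The flowed plaquette** `V_t(p)` for the plaquette `p` at `x` in the `(μ, ν)`-plane,
`V_t(x,μ) V_t(x+μ̂,ν) V_t(x+ν̂,μ)† V_t(x,ν)†` (for `μ = ν` a junk value). [cite: Luscher2010, eq. (3.1)] -/
def flowedPlaquette (t : ℝ) (U : (Fin d → R) × Fin d → G) (x : Fin d → R) (μ ν : Fin d) :
    Matrix (Fin N) (Fin N) ℂ :=
  wilsonFlowMatrix ρ t U (x, μ) * wilsonFlowMatrix ρ t U (x + Pi.single μ 1, ν) *
    (wilsonFlowMatrix ρ t U (x + Pi.single ν 1, μ))ᴴ * (wilsonFlowMatrix ρ t U (x, ν))ᴴ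

/-- **The flowed action density `E_t(x)` (plaquette definition, lattice units)**:
`E = 2 ∑_{p ∈ P_x} Re tr{1 − V_t(p)}`, `P_x` the unoriented plaquettes with lower-left corner `x`,
i.e. `2 ∑_{μ<ν} (N − Re tr V_t(p_{x,μν}))`. The physical density at spacing `a` and physical flow
time `t` is `a⁻⁴ · flowedEnergy ρ (t/a²) x U`. [cite: Luscher2010, eq. (3.1)] -/
def flowedEnergy (t : ℝ) (x : Fin d → R) (U : (Fin d → R) × Fin d → G) : ℝ :=
  2 * ∑ μ : Fin d, ∑ ν : Fin d,
    if μ < ν then ((N : ℝ) - (flowedPlaquette ρ t U x μ ν).trace.re) else 0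

/-- **The clover field tensor `a² G_{μν}(x)` at flow time `t`** (Lüscher Fig. 1): `π_𝔤` of the
average of the four plaquette loops in the `(μ, ν)`-plane through `x`, all with the orientation
`μ → ν` and starting and ending at `x` (for `𝔤 = 𝔰𝔲(N)`, `π_𝔤` = "anti-hermitian traceless
part"). [cite: Luscher2010, §3.2 Fig. 1] -/
def flowedClover (t : ℝ) (U : (Fin d → R) × Fin d → G) (x : Fin d → R) (μ ν : Fin d) :
    Matrix (Fin N) (Fin N) ℂ :=
  let V := wilsonFlowMatrix ρ t U
  let eμ : Fin d → R := Pi.single μ 1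
  let eν : Fin d → R := Pi.single ν 1
  lieProjection (Set.range ρ) <| (1 / 4 : ℝ) •
    (V (x, μ) * V (x + eμ, ν) * (V (x + eν, μ))ᴴ * (V (x, ν))ᴴ +
      V (x, ν) * (V (x - eμ + eν, μ))ᴴ * (V (x - eμ, ν))ᴴ * V (x - eμ, μ) +
      (V (x - eμ, μ))ᴴ * (V (x - eμ - eν, ν))ᴴ * V (x - eμ - eν, μ) * V (x - eν, ν) +
      (V (x - eν, ν))ᴴ * V (x - eν, μ) * V (x - eν + eμ, ν) * (V (x, μ))ᴴ)

/-- **The flowed action density, symmetric (clover) definition**: `E = ¼ Gᵃ_{μν} Gᵃ_{μν}` (2.1)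
with the clover `G_{μν}` of Fig. 1; since `Gᵃ Gᵃ = −2 tr G² = 2 Re tr(G† G)` under (A.2) and
`G_{νμ} = −G_{μν}`, this is `∑_{μ<ν} Re tr(G_{μν}(x)† G_{μν}(x))` (lattice units; the definition
used for the values of `t₀` in Lüscher's Table 1). [cite: Luscher2010, eq. (2.1) and §3.2] -/
def flowedCloverEnergy (t : ℝ) (x : Fin d → R) (U : (Fin d → R) × Fin d → G) : ℝ :=
  ∑ μ : Fin d, ∑ ν : Fin d,
    if μ < ν then ((flowedClover ρ t U x μ ν)ᴴ * flowedClover ρ t U x μ ν).trace.re else 0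

/-- At flow time `0` the flowed link matrices are `ρ(U)`. [cite: Luscher2010, eq. (1.4)] -/
@[simp]
theorem wilsonFlowMatrix_zero (U : (Fin d → R) × Fin d → G) :
    wilsonFlowMatrix ρ 0 U = fun e => ρ (U e) :=
  matrixWilsonFlow_zero _ _

/-- At flow time `0` the Wilson flow is the identity, for faithful `ρ`. [cite: Luscher2010, eq. (1.4)] -/
@[simp]
theorem latticeWilsonFlow_zero (hρ : Function.Injective ρ) (U : (Fin d → R) × Fin d → G) :
    latticeWilsonFlow ρ 0 U = U := by
  funext e
  simp only [latticeWilsonFlow, wilsonFlowMatrix_zero]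
  exact Function.leftInverse_invFun hρ (U e)

/-- For a unitary-valued representation, `ρ(g)† = ρ(g⁻¹)`. [folklore] -/
theorem conjTranspose_map_of_mem_unitaryGroup (hρ : ∀ g, ρ g ∈ Matrix.unitaryGroup (Fin N) ℂ)
    (g : G) : (ρ g)ᴴ = ρ g⁻¹ := by
  have h1 : (ρ g)ᴴ * ρ g = 1 := Matrix.mem_unitaryGroup_iff'.1 (hρ g)
  have h2 : ρ g * ρ g⁻¹ = 1 := by rw [← map_mul, mul_inv_cancel, map_one]
  calc (ρ g)ᴴ = (ρ g)ᴴ * (ρ g * ρ g⁻¹) := by rw [h2, Matrix.mul_one]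
    _ = ρ g⁻¹ := by rw [← Matrix.mul_assoc, h1, Matrix.one_mul]

/-- At flow time `0`, for unitary `ρ`, the flowed plaquette is `ρ` of the tree's plaquette
holonomy `plaquetteHolonomy U x μ ν` (torus). [folklore] -/
theorem flowedPlaquette_zero {L : ℕ} (hρ : ∀ g, ρ g ∈ Matrix.unitaryGroup (Fin N) ℂ)
    (U : Literature.MathematicalPhysics.QuantumFieldTheory.GaugeConfig d L G)
    (x : Literature.MathematicalPhysics.QuantumFieldTheory.Site d L) (μ ν : Fin d) :
    flowedPlaquette ρ 0 U x μ ν =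
      ρ (Literature.MathematicalPhysics.QuantumFieldTheory.plaquetteHolonomy U x μ ν) := by
  simp only [flowedPlaquette, wilsonFlowMatrix_zero, conjTranspose_map_of_mem_unitaryGroup ρ hρ,
    ← map_mul, Literature.MathematicalPhysics.QuantumFieldTheory.plaquetteHolonomy,
    Literature.MathematicalPhysics.QuantumFieldTheory.Site.shift]

/-- **Consistency with the tree's Wilson action at `t = 0`**: on the torus, for unitary `ρ`,
`∑ₓ E₀(x) = 2 · wilsonAction ρ U` — Lüscher's (3.1)/(1.3) count oriented plaquettes, the tree's
`wilsonAction ρ U = ∑_{unoriented p} (N − Re tr ρ(U_p))` unoriented ones. [cite: Luscher2010, eqs. (1.3) and (3.1)] -/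
theorem sum_flowedEnergy_zero {L : ℕ} [NeZero L] (hρ : ∀ g, ρ g ∈ Matrix.unitaryGroup (Fin N) ℂ)
    (U : Literature.MathematicalPhysics.QuantumFieldTheory.GaugeConfig d L G) :
    ∑ x, flowedEnergy ρ 0 x U =
      2 * Literature.MathematicalPhysics.QuantumFieldTheory.wilsonAction ρ U := by
  simp only [flowedEnergy, flowedPlaquette_zero ρ hρ, ← Finset.mul_sum,
    Literature.MathematicalPhysics.QuantumFieldTheory.wilsonAction]
  congr 1
  rw [Fintype.sum_prod_type]
  refine Finset.sum_congr rfl fun x _ => ?_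
  rw [← Finset.sum_product', Finset.univ_product_univ, ← Finset.sum_filter,
    Finset.sum_subtype (p := fun q : Fin d × Fin d => q.1 < q.2)
      (Finset.univ.filter fun q : Fin d × Fin d => q.1 < q.2) (fun q => by simp)]

end GroupLevel

end Literature.MathematicalPhysics.QuantumLattice
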